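import Summits.Ventures.PercRepro.S2TriangleStarFull

/-!
# PercRepro — LEMMA T′, PART B: THE TRIANGLE COUNT AT BOUNDED NULLITY, SHARPENED — `s₃ ≤ 1 + d(d − 1)/2` (p7, gen 3; S2)

p2's LEMMA T (S1TriangleCount: `2·s₃ ≤ d(d + 1)` under (C1), by deletion induction with «at most `d` triangles through
a point») loses one triangle at every step: if a point `e` lies on EXACTLY `d` triangles, then their union `U`
(`2d + 1` points of rank `d + 1`, S2TriangleStarFull) carries the whole nullity, so every circuit lies inside `U`
(`isCircuit_subset_of_nullity_full`), and no triangle inside `U` avoids `e` (`no_triangle_avoiding_of_card_eq`: a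
triangle containing a full pair `T_i ∖ {e}` would put four points on a line, (C1) — `no_pair_of_trianglesThrough`;
a triangle meeting three pairs would be independent, since those three triangles through `e` span rank exactly `4`
by submodularity against the remaining `d − 3`, and they lie in `cl (insert e T)`). Hence `s₃ = d` in that case, and
otherwise at most `d − 1` triangles pass through `e`: `s₃(d) ≤ (d − 1) + s₃(d − 1)`, so
**`s₃ ≤ 1 + d(d − 1)/2`** for `d ≥ 1` (`ncard_triangles_le_one_add`; `= d(d+1)/2 − (d − 1)`, tight at `d = 3`:
the complete quadrilateral). Axioms: standard.
-/

open scoped Matroid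

namespace PercRepro

namespace S2

open Set

variable {α : Type}

/-- **No triangle avoids `e` when `e` lies on exactly `d` triangles** (under (C1), `|E| = r(E) + d`). -/
theorem no_triangle_avoiding_of_card_eq (M : Matroid α) [M.Finite]
    (hC1 : ∀ L ⊆ M.E, M.eRk L = 2 → L.ncard ≤ 3) {e : α} (hx : M.IsNonloop e) {d : ℕ}
    (hd : M.E.encard = M.eRank + d) (hcard : (trianglesThroughF M e).card = d)
    {T : Set α} (hT : M.IsCircuit T) (hT3 : T.ncard = 3) (heT : e ∉ T) : False := by
  classical
  set s := trianglesThroughF M e with hsdef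
  have hs : ∀ C ∈ s, C ∈ ThmN.trianglesThrough M e := fun C hC => (mem_trianglesThroughF M).1 hC
  set U : Set α := {e} ∪ ⋃ C ∈ s, C with hU
  obtain ⟨hrU, hcU⟩ := eRk_star_eq_of_card_eq M hC1 hx hd hcard
  have hUE : U ⊆ M.E := by
    intro z hz
    rcases hz with hz | hz
    · rw [Set.mem_singleton_iff.1 hz]; exact hx.mem_ground
    · obtain ⟨C, hC, hzC⟩ := Set.mem_iUnion₂.1 hz
      exact (hs C hC).1.subset_ground hzC
  have hTE : T ⊆ M.E := hT.subset_ground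
  have hTfin : T.Finite := M.ground_finite.subset hTE
  -- the triangle lies inside the star
  have hTU : T ⊆ U := isCircuit_subset_of_nullity_full M hd hUE hrU (by rw [hcU]; ring) hT
  -- every point of `T` lies on a triangle through `e`
  have hmem : ∀ a ∈ T, ∃ C ∈ s, a ∈ C := by
    intro a ha
    have := hTU ha
    rcases this with h | h
    · exact absurd (Set.mem_singleton_iff.1 h ▸ ha) heT
    · obtain ⟨C, hC, haC⟩ := Set.mem_iUnion₂.1 h
      exact ⟨C, hC, haC⟩
  -- the three points of `T`
  obtain ⟨x, y, z, hxy, hxz, hyz, hTxyz⟩ := Set.ncard_eq_three.1 hT3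
  have hxT : x ∈ T := by rw [hTxyz]; simp
  have hyT : y ∈ T := by rw [hTxyz]; simp
  have hzT : z ∈ T := by rw [hTxyz]; simp
  obtain ⟨Cx, hCx, hxCx⟩ := hmem x hxT
  obtain ⟨Cy, hCy, hyCy⟩ := hmem y hyT
  obtain ⟨Cz, hCz, hzCz⟩ := hmem z hzT
  have hex : e ≠ x := fun h => heT (h ▸ hxT)
  have hey : e ≠ y := fun h => heT (h ▸ hyT)
  have hez : e ≠ z := fun h => heT (h ▸ hzT)
  have hpair : ∀ {C : Set α} {a b : α}, C ∈ s → a ∈ C → b ∈ C → a ∈ T → b ∈ T → a ≠ b → False :=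
    fun hC haC hbC haT hbT hab => no_pair_of_trianglesThrough M hC1 hx hT hT3 heT (hs _ hC) haC hbC haT hbT hab
  -- hence the three triangles `Cx, Cy, Cz` are pairwise distinct
  have hxy' : Cx ≠ Cy := fun h => hpair hCx hxCx (h ▸ hyCy) hxT hyT hxy
  have hxz' : Cx ≠ Cz := fun h => hpair hCx hxCx (h ▸ hzCz) hxT hzT hxz
  have hyz' : Cy ≠ Cz := fun h => hpair hCy hyCy (h ▸ hzCz) hyT hzT hyz
  -- the three triangles through `e` span rank exactly `4` (submodularity against the other `d − 3`)
  set t : Finset (Set α) := {Cx, Cy, Cz} with ht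
  have htcard : t.card = 3 := by
    rw [ht, Finset.card_insert_of_notMem (by simp [hxy', hxz']), Finset.card_pair hyz']
  have hts : t ⊆ s := by
    intro C hC
    rw [ht, Finset.mem_insert, Finset.mem_insert, Finset.mem_singleton] at hC
    rcases hC with rfl | rfl | rfl
    · exact hCx
    · exact hCy
    · exact hCz
  set W : Set α := {e} ∪ ⋃ C ∈ t, C with hW
  set V : Set α := {e} ∪ ⋃ C ∈ s \ t, C with hV
  have hW4 : M.eRk W ≤ ((1 + 3 : ℕ) : ℕ∞) := by
    have := (ThmN.eRk_le_and_ncard_eq_of_triangles M hC1 hx t (fun C hC => hs C (hts hC))).1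
    rwa [htcard] at this
  have hVr : M.eRk V ≤ ((1 + (d - 3) : ℕ) : ℕ∞) := by
    have := (ThmN.eRk_le_and_ncard_eq_of_triangles M hC1 hx (s \ t)
      (fun C hC => hs C (Finset.mem_sdiff.1 hC).1)).1
    rwa [Finset.card_sdiff_of_subset hts, hcard, htcard] at this
  have hUVW : U ⊆ V ∪ W := by
    intro w hw
    rcases hw with hw | hw
    · exact Or.inl (Or.inl hw)
    · obtain ⟨C, hC, hwC⟩ := Set.mem_iUnion₂.1 hw
      by_cases hCt : C ∈ t
      · exact Or.inr (Or.inr (Set.mem_iUnion₂.2 ⟨C, hCt, hwC⟩))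
      · exact Or.inl (Or.inr (Set.mem_iUnion₂.2 ⟨C, Finset.mem_sdiff.2 ⟨hC, hCt⟩, hwC⟩))
  have heVW : e ∈ V ∩ W := ⟨Or.inl (Set.mem_singleton e), Or.inl (Set.mem_singleton e)⟩
  have hVWr : (1 : ℕ∞) ≤ M.eRk (V ∩ W) := by
    rw [← hx.eRk_eq]
    exact M.eRk_mono (Set.singleton_subset_iff.2 heVW)
  have hsub := M.eRk_inter_add_eRk_union_le V W
  have hUr : ((d + 1 : ℕ) : ℕ∞) ≤ M.eRk (V ∪ W) := by rw [← hrU]; exact M.eRk_mono hUVW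
  have hWE : W ⊆ M.E := by
    intro w hw
    rcases hw with hw | hw
    · rw [Set.mem_singleton_iff.1 hw]; exact hx.mem_ground
    · obtain ⟨C, hC, hwC⟩ := Set.mem_iUnion₂.1 hw
      exact (hs C (hts hC)).1.subset_ground hwC
  have hVE : V ⊆ M.E := by
    intro w hw
    rcases hw with hw | hw
    · rw [Set.mem_singleton_iff.1 hw]; exact hx.mem_ground
    · obtain ⟨C, hC, hwC⟩ := Set.mem_iUnion₂.1 hw
      exact (hs C (Finset.mem_sdiff.1 hC).1).1.subset_ground hwC
  have hWfin : W.Finite := M.ground_finite.subset hWE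
  have hVfin : V.Finite := M.ground_finite.subset hVE
  have hne1 : M.eRk W ≠ ⊤ := ((M.eRk_le_encard _).trans_lt hWfin.encard_lt_top).ne
  have hne2 : M.eRk V ≠ ⊤ := ((M.eRk_le_encard _).trans_lt hVfin.encard_lt_top).ne
  have hne3 : M.eRk (V ∩ W) ≠ ⊤ :=
    ((M.eRk_le_encard _).trans_lt (hVfin.inter_of_left W).encard_lt_top).ne
  have hne4 : M.eRk (V ∪ W) ≠ ⊤ := ((M.eRk_le_encard _).trans_lt (hVfin.union hWfin).encard_lt_top).ne
  obtain ⟨rw_, hrw⟩ := ENat.ne_top_iff_exists.1 hne1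
  obtain ⟨rv, hrv⟩ := ENat.ne_top_iff_exists.1 hne2
  obtain ⟨ri, hri⟩ := ENat.ne_top_iff_exists.1 hne3
  obtain ⟨ru, hru⟩ := ENat.ne_top_iff_exists.1 hne4
  rw [← hrw] at hW4
  rw [← hrv] at hVr
  rw [← hri] at hVWr
  rw [← hru] at hUr
  rw [← hrw, ← hrv, ← hri, ← hru] at hsub
  have e1 : rw_ ≤ 1 + 3 := by exact_mod_cast hW4
  have e2 : rv ≤ 1 + (d - 3) := by exact_mod_cast hVr
  have e3 : 1 ≤ ri := by exact_mod_cast hVWr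
  have e4 : d + 1 ≤ ru := by exact_mod_cast hUr
  have e5 : ri + ru ≤ rv + rw_ := by exact_mod_cast hsub
  have hd3 : 3 ≤ d := by rw [← hcard]; exact (Finset.card_le_card hts).trans' (by rw [htcard])
  have hW4' : rw_ = 4 := by omega
  -- `W ⊆ cl (insert e T)`: each triangle through `e` and a point of `T` lies in the closure of `{e}` and that point
  have hclW : W ⊆ M.closure (insert e T) := by
    have hins : insert e T ⊆ M.E := Set.insert_subset hx.mem_ground hTE
    have hkey : ∀ {C : Set α} {a : α}, C ∈ s → a ∈ C → a ∈ T → C ⊆ M.closure (insert e T) :=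
      fun hC haC haT => trianglesThrough_subset_closure_insert M hx hT heT (hs _ hC) haC haT
    intro w hw
    rcases hw with hw | hw
    · exact M.subset_closure _ hins (by rw [Set.mem_singleton_iff.1 hw]; exact Set.mem_insert e T)
    · obtain ⟨C, hC, hwC⟩ := Set.mem_iUnion₂.1 hw
      rw [ht, Finset.mem_insert, Finset.mem_insert, Finset.mem_singleton] at hC
      rcases hC with rfl | rfl | rfl
      · exact hkey hCx hxCx hxT hwC
      · exact hkey hCy hyCy hyT hwC
      · exact hkey hCz hzCz hzT hwC
  -- so `insert e T` (four points) has rank `4`: independent, contradicting the circuit `T`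
  have hT4 : (insert e T).encard = 4 := by
    rw [Set.encard_insert_of_notMem heT, ← hTfin.cast_ncard_eq, hT3]; rfl
  have hr4 : M.eRk (insert e T) = 4 := by
    apply le_antisymm
    · calc M.eRk (insert e T) ≤ (insert e T).encard := M.eRk_le_encard _
        _ = 4 := hT4
    · calc (4 : ℕ∞) = ((rw_ : ℕ) : ℕ∞) := by rw [hW4']; rfl
        _ = M.eRk W := hrw
        _ ≤ M.eRk (M.closure (insert e T)) := M.eRk_mono hclW
        _ = M.eRk (insert e T) := M.eRk_closure_eq _
  have hindep : M.Indep (insert e T) := by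
    rw [_root_.Matroid.indep_iff_eRk_eq_encard_of_finite (hTfin.insert e), hr4, hT4]
  exact hT.not_indep (hindep.subset (Set.subset_insert e T))

/-- **LEMMA T′ — the triangle count at bounded nullity, sharpened.** If `|E| = r(E) + d`, `d ≥ 1`, and every
rank-`2` set has at most `3` elements, then `M` has at most `1 + d(d − 1)/2` triangles. -/
theorem ncard_triangles_le_one_add (M : Matroid α) [M.Finite]
    (hC1 : ∀ L ⊆ M.E, M.eRk L = 2 → L.ncard ≤ 3) {d : ℕ} (hd : M.E.encard = M.eRank + d) (hd1 : 1 ≤ d) :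
    (ThmN.triangles M).ncard ≤ 1 + d * (d - 1) / 2 := by
  suffices H : ∀ n : ℕ, ∀ (M : Matroid α) [M.Finite], M.E.ncard = n →
      (∀ L ⊆ M.E, M.eRk L = 2 → L.ncard ≤ 3) → ∀ d : ℕ, M.E.encard = M.eRank + d → 1 ≤ d →
      (ThmN.triangles M).ncard ≤ 1 + d * (d - 1) / 2 from H _ M rfl hC1 d hd hd1
  intro n
  induction n using Nat.strong_induction_on with
  | _ n ih =>
  intro M _ hn hC1 d hd hd1
  classical
  set S := ThmN.triangles M with hS
  have hSfin : S.Finite :=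
    M.ground_finite.finite_subsets.subset (fun C hC => hC.1.subset_ground)
  by_cases hSe : S = ∅
  · rw [hSe, ncard_empty]; exact Nat.zero_le _
  obtain ⟨C₀, hC₀⟩ := nonempty_iff_ne_empty.2 hSe
  obtain ⟨e, heC₀⟩ := hC₀.1.nonempty
  have heE : e ∈ M.E := hC₀.1.subset_ground heC₀
  have hne : ¬ M.IsColoop e := hC₀.1.not_isColoop_of_mem heC₀
  have hν : M✶.eRank = (d : ℕ∞) := by
    have h := _root_.Matroid.eRank_add_eRank_dual M
    rw [hd] at h
    exact WithTop.add_left_cancel (PercRepro.Matroid.eRank_ne_top_of_finite M) h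
  have hdel := PercRepro.Matroid.dual_eRank_delete_singleton_add_one heE hne
  rw [hν] at hdel
  have hfin' : (M ＼ {e})✶.eRank ≠ ⊤ := by
    intro h
    rw [h] at hdel
    exact absurd hdel (by simp)
  obtain ⟨d', hd'⟩ := ENat.ne_top_iff_exists.1 hfin'
  have hdd' : d = d' + 1 := by
    rw [← hd'] at hdel
    exact_mod_cast hdel.symm
  have hd'enc : (M ＼ {e}).E.encard = (M ＼ {e}).eRank + d' := by
    have h := _root_.Matroid.eRank_add_eRank_dual (M ＼ {e})
    rw [← hd'] at h
    exact h.symm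
  have hdelE : (M ＼ {e}).E.ncard < n := by
    rw [_root_.Matroid.delete_ground, ← hn, ← ncard_sdiff_singleton_add_one heE M.ground_finite]
    omega
  have hC1' : ∀ L ⊆ (M ＼ {e}).E, (M ＼ {e}).eRk L = 2 → L.ncard ≤ 3 := by
    intro L hL hr
    rw [_root_.Matroid.delete_ground] at hL
    rw [delete_singleton_eRk_eq hL] at hr
    exact hC1 L (hL.trans sdiff_subset) hr
  set S₁ := ThmN.trianglesThrough M e with hS₁
  set S₂ := {C | M.IsCircuit C ∧ C.ncard = 3 ∧ e ∉ C} with hS₂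
  have hsplit : S ⊆ S₁ ∪ S₂ := by
    intro C hC
    by_cases h : e ∈ C
    · exact Or.inl ⟨hC.1, hC.2, h⟩
    · exact Or.inr ⟨hC.1, hC.2, h⟩
  have hS₁fin : S₁.Finite := hSfin.subset (fun C hC => ⟨hC.1, hC.2.1⟩)
  have hS₂fin : S₂.Finite := hSfin.subset (fun C hC => ⟨hC.1, hC.2.1⟩)
  have hx : M.IsNonloop e := by
    refine _root_.Matroid.isNonloop_of_not_isLoop heE ?_
    intro hloop
    have hC₀e : C₀ = {e} := hloop.eq_of_isCircuit_mem hC₀.1 heC₀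
    have := hC₀.2
    rw [hC₀e, ncard_singleton] at this
    omega
  have h1 : S₁.ncard ≤ d := ThmN.ncard_trianglesThrough_le M hC1 hx hd
  have h3 : S.ncard ≤ S₁.ncard + S₂.ncard :=
    (ncard_le_ncard hsplit (hS₁fin.union hS₂fin)).trans (ncard_union_le _ _)
  have hS₁pos : 0 < S₁.ncard := by
    have : C₀ ∈ S₁ := ⟨hC₀.1, hC₀.2, heC₀⟩
    exact (Set.ncard_pos hS₁fin).2 ⟨C₀, this⟩
  rcases Nat.lt_or_ge S₁.ncard d with hlt | hge
  · -- at most `d − 1` triangles through `e`: induction on `M ＼ {e}`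
    have h2 : S₂.ncard ≤ 1 + d' * (d' - 1) / 2 := by
      have hsub : S₂ ⊆ ThmN.triangles (M ＼ {e}) := by
        intro C hC
        exact ⟨_root_.Matroid.delete_isCircuit_iff.2 ⟨hC.1, disjoint_singleton_right.2 hC.2.2⟩, hC.2.1⟩
      have hd'1 : 1 ≤ d' := by
        -- `d' = 0` would force `S₁.ncard < 1`
        omega
      calc S₂.ncard ≤ (ThmN.triangles (M ＼ {e})).ncard :=
            ncard_le_ncard hsub
              ((M ＼ {e}).ground_finite.finite_subsets.subset (fun C hC => hC.1.subset_ground))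
        _ ≤ 1 + d' * (d' - 1) / 2 := ih _ hdelE (M ＼ {e}) rfl hC1' d' hd'enc hd'1
    subst hdd'
    have hle : S.ncard ≤ d' + (1 + d' * (d' - 1) / 2) := by omega
    have hx2 : 2 * (d' * (d' - 1) / 2) = d' * (d' - 1) :=
      Nat.two_mul_div_two_of_even (Nat.even_mul_pred_self d')
    have hy2 : 2 * ((d' + 1) * d' / 2) = (d' + 1) * d' := by
      rw [mul_comm (d' + 1) d']
      exact Nat.two_mul_div_two_of_even (Nat.even_mul_succ_self d')
    have hxy : (d' + 1) * d' = d' * (d' - 1) + 2 * d' := by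
      cases d' with
      | zero => simp
      | succ k => simp only [Nat.add_sub_cancel]; ring
    rw [show d' + 1 - 1 = d' by omega]
    omega
  · -- exactly `d` triangles through `e`: no other triangle
    have hS₁eq : S₁.ncard = d := le_antisymm h1 hge
    have hS₂e : S₂ = ∅ := by
      rw [Set.eq_empty_iff_forall_notMem]
      intro C hC
      have hcard : (trianglesThroughF M e).card = d := by rw [card_trianglesThroughF]; exact hS₁eq
      exact no_triangle_avoiding_of_card_eq M hC1 hx hd hcard hC.1 hC.2.1 hC.2.2
    rw [hS₂e, ncard_empty] at h3
    have hdd : d ≤ 1 + d * (d - 1) / 2 := by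
      rcases Nat.lt_or_ge d 2 with h | h
      · interval_cases d; simp
      · have : d * (d - 1) / 2 ≥ d - 1 := by
          calc d * (d - 1) / 2 ≥ 2 * (d - 1) / 2 := Nat.div_le_div_right (Nat.mul_le_mul_right _ h)
            _ = d - 1 := by omega
        omega
    omega

end S2

end PercRepro
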